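import Literature.Probability.Process.BrownianConcatenation
import HarnessLib

/-!
# Concatenation with an independent Brownian motion: almost surely continuous paths

Topic `Probability/Process`; theorems only. The chain of `BrownianConcatenation.lean`
(`isBrownianReal_concat`: a process `Y` with martingale clock `t ∧ σ`, concatenated after `σ` with an
independent Brownian motion, is a Brownian motion; Revuz–Yor (1999) Ch. V Thm. (1.6)) asks for
continuous paths of `Y` at EVERY `ω`, but uses continuity only almost surely (through
`HasMartingaleClock.integral_mul_cexp_eq`) and for the continuity field of `IsBrownianReal` (an a.s.
statement). This file records the same chain with `hcont : ∀ᵐ ω ∂Q, Continuous (Y · ω)` — needed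
when `Y` is a time-changed modification (through-swallow image driving value of the locality of
SLE₆, crux `stmt-CriticalPhenomena-0698`). Proofs verbatim.
-/

noncomputable section

open MeasureTheory ProbabilityTheory Filter Set Function Complex
open scoped NNReal ENNReal Topology
open Literature.Probability.RandomPlanarGeometry

namespace Literature.Probability.Process

section IdentityAE

variable {Ω₁ : Type*} {m₁ : MeasurableSpace Ω₁} {Q : Measure Ω₁} [IsProbabilityMeasure Q]
  {𝓕 : Filtration ℝ≥0 m₁} {Y : ℝ≥0 → Ω₁ → ℝ} {σ : Ω₁ → ℝ≥0} {N : ℝ}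

/-- **The exponential martingale identity of the concatenation (deterministic clock).** Let `Y`
have the martingale clock `t ∧ σ` on `(Ω₁, 𝓕, Q)` (`HasMartingaleClock`), be adapted with continuous
paths, and let `c_t = t ∧ σ` be adapted. For `s ≤ t`, real `u` and a complex weight `G` on the
product with the canonical Brownian motion, measurable for `𝓕_s ⊗ σ(B_v, v ≤ s)` with `‖G‖ ≤ 1`:
`E[G e^{iu(M_t - M_s) + u²(t-s)/2}] = E[G]`, `M_t = Y_t + B_t - B_{t ∧ σ}` (Fubini over the Brownian
factor, the simple Markov property of `B` after the `ω₁`-measurable time `s ∨ (t ∧ σ) ≥ s`, and the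
exponential identity `HasMartingaleClock.integral_mul_cexp_eq` for `Y`).
[cite: RevuzYor1999, Ch. V Thm (1.6) (proof)] -/
theorem integral_mul_cexp_concat_eq_ae
    (h : HasMartingaleClock Y (fun t ω ↦ ((min t (σ ω) : ℝ≥0) : ℝ)) 𝓕 Q N)
    (hcont : ∀ᵐ ω ∂Q, Continuous (Y · ω)) (hYad : ∀ t, StronglyMeasurable[𝓕 t] (Y t)) (hσm : Measurable σ)
    (hcad : ∀ t, Measurable[𝓕 t] fun ω ↦ min t (σ ω))
    {s t : ℝ≥0} (hst : s ≤ t) (u : ℝ) {G : Ω₁ × (ℝ≥0 → ℝ) → ℂ}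
    (hG : StronglyMeasurable[(𝓕 s).prod (brownianFiltration s)] G) (hG1 : ∀ ω, ‖G ω‖ ≤ 1) :
    ∫ ω, G ω * cexp (I * (u * ((Y t ω.1 + (Process.brownian t ω.2 - Process.brownian (min t (σ ω.1)) ω.2)) -
        (Y s ω.1 + (Process.brownian s ω.2 - Process.brownian (min s (σ ω.1)) ω.2))) : ℝ) +
        (u ^ 2 * ((t : ℝ) - s) / 2 : ℝ)) ∂(Q.prod Process.preWienerMeasure) =
      ∫ ω, G ω ∂(Q.prod Process.preWienerMeasure) := by
  haveI : IsProbabilityMeasure Process.preWienerMeasure := isProbabilityMeasure_preWienerMeasure'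
  set W : Measure (ℝ≥0 → ℝ) := Process.preWienerMeasure with hWdef
  set B : ℝ≥0 → (ℝ≥0 → ℝ) → ℝ := Process.brownian with hBdef
  set r : Ω₁ → ℝ≥0 := fun ω₁ ↦ max s (min t (σ ω₁)) with hrdef
  have hr : ∀ ω₁, s ≤ r ω₁ ∧ r ω₁ ≤ t := fun ω₁ ↦ le_max_min_and (σ ω₁) hst
  have hrm : Measurable r := measurable_const.max (measurable_const.min hσm)
  -- measurability of `G` for the full product σ-algebra, and of its sections
  have hGm : StronglyMeasurable G := hG.mono (prod_filtration_le s)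
  have hGsec : ∀ ω₁, StronglyMeasurable[brownianFiltration s] fun ω₂ ↦ G (ω₁, ω₂) :=
    stronglyMeasurable_section hG
  -- the rewritten integrand
  set F : Ω₁ × (ℝ≥0 → ℝ) → ℂ := fun ω ↦ G ω * cexp (I * (u * ((Y t ω.1 - Y s ω.1) +
      (B t ω.2 - B (r ω.1) ω.2)) : ℝ) + (u ^ 2 * ((t : ℝ) - s) / 2 : ℝ)) with hFdef
  have hFeq : (fun ω : Ω₁ × (ℝ≥0 → ℝ) ↦ G ω * cexp (I * (u * ((Y t ω.1 + (B t ω.2 - B (min t (σ ω.1)) ω.2)) -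
      (Y s ω.1 + (B s ω.2 - B (min s (σ ω.1)) ω.2))) : ℝ) + (u ^ 2 * ((t : ℝ) - s) / 2 : ℝ))) = F := by
    funext ω
    simp only [hFdef]
    have key : (Y t ω.1 + (B t ω.2 - B (min t (σ ω.1)) ω.2)) - (Y s ω.1 + (B s ω.2 - B (min s (σ ω.1)) ω.2)) =
        (Y t ω.1 - Y s ω.1) + (B t ω.2 - B (r ω.1) ω.2) := by
      have := concat_increment (B · ω.2) (σ ω.1) hst
      simp only [hrdef]
      rw [← this]
      ring
    rw [key]
  rw [hFeq]
  -- `F` is bounded and measurable, hence integrable on the product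
  set K : ℝ := Real.exp (u ^ 2 * ((t : ℝ) - s) / 2) with hKdef
  have hBm : Measurable (uncurry B) := measurable_uncurry_brownian
  have hΦm : Measurable fun ω : Ω₁ × (ℝ≥0 → ℝ) ↦ (Y t ω.1 - Y s ω.1) + (B t ω.2 - B (r ω.1) ω.2) := by
    have hY : ∀ v, Measurable fun ω : Ω₁ × (ℝ≥0 → ℝ) ↦ Y v ω.1 := fun v ↦
      ((hYad v).mono (𝓕.le v)).measurable.comp measurable_fst
    have hB1 : Measurable fun ω : Ω₁ × (ℝ≥0 → ℝ) ↦ B t ω.2 :=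
      (Process.stronglyMeasurable_brownian t).measurable.comp measurable_snd
    have hB2 : Measurable fun ω : Ω₁ × (ℝ≥0 → ℝ) ↦ B (r ω.1) ω.2 :=
      hBm.comp ((hrm.comp measurable_fst).prodMk measurable_snd)
    exact ((hY t).sub (hY s)).add (hB1.sub hB2)
  have hEm : Measurable fun ω : Ω₁ × (ℝ≥0 → ℝ) ↦
      cexp (I * (u * ((Y t ω.1 - Y s ω.1) + (B t ω.2 - B (r ω.1) ω.2)) : ℝ) + (u ^ 2 * ((t : ℝ) - s) / 2 : ℝ)) :=
    (by fun_prop : Measurable fun y : ℝ ↦ cexp (I * (u * y : ℝ) + (u ^ 2 * ((t : ℝ) - s) / 2 : ℝ))).comp hΦm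
  have hEnorm : ∀ ω : Ω₁ × (ℝ≥0 → ℝ),
      ‖cexp (I * (u * ((Y t ω.1 - Y s ω.1) + (B t ω.2 - B (r ω.1) ω.2)) : ℝ) + (u ^ 2 * ((t : ℝ) - s) / 2 : ℝ))‖ = K := by
    intro ω
    rw [Complex.norm_exp, hKdef]
    congr 1
    simp only [Complex.add_re, Complex.mul_re, Complex.I_re, Complex.I_im, Complex.ofReal_re,
      Complex.ofReal_im]
    ring
  have hFm : AEStronglyMeasurable F (Q.prod W) := (hGm.measurable.mul hEm).aestronglyMeasurable
  have hFint : Integrable F (Q.prod W) := by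
    refine Integrable.mono' (integrable_const K) hFm (ae_of_all _ fun ω ↦ ?_)
    simp only [hFdef]
    rw [norm_mul, hEnorm ω]
    exact mul_le_of_le_one_left (Real.exp_pos _).le (hG1 ω)
  have hGint : Integrable G (Q.prod W) :=
    Integrable.mono' (integrable_const (1 : ℝ)) hGm.aestronglyMeasurable (ae_of_all _ hG1)
  -- Fubini
  rw [integral_prod F hFint, integral_prod G hGint]
  -- the inner integral
  set Gbar : Ω₁ → ℂ := fun ω₁ ↦ ∫ ω₂, G (ω₁, ω₂) ∂W with hGbar
  have hinner : ∀ ω₁, ∫ ω₂, F (ω₁, ω₂) ∂W = Gbar ω₁ *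
      cexp (I * (u * (Y t ω₁ - Y s ω₁) : ℝ) + (u ^ 2 * (((min t (σ ω₁) : ℝ≥0) : ℝ) - ((min s (σ ω₁) : ℝ≥0) : ℝ)) / 2 : ℝ)) := by
    intro ω₁
    have hsplit : ∀ ω₂, F (ω₁, ω₂) = cexp (I * (u * (Y t ω₁ - Y s ω₁) : ℝ) + (u ^ 2 * ((t : ℝ) - s) / 2 : ℝ)) *
        (G (ω₁, ω₂) * cexp (I * (u * (B t ω₂ - B (r ω₁) ω₂) : ℝ))) := by
      intro ω₂
      simp only [hFdef]
      rw [mul_left_comm, ← Complex.exp_add]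
      congr 2
      push_cast
      ring
    simp_rw [hsplit]
    rw [integral_const_mul, integral_mul_cexp_brownian_sub (hr ω₁).1 (hr ω₁).2 u (hGsec ω₁)]
    simp only [hGbar]
    rw [← mul_assoc, ← Complex.exp_add, mul_comm]
    congr 2
    have key := congrArg (fun x : ℝ ↦ (x : ℂ)) (sub_max_min_eq (σ ω₁) hst)
    simp only [hrdef]
    push_cast at key ⊢
    linear_combination (-(u : ℂ) ^ 2 / 2) * key
  simp_rw [hinner]
  -- `Gbar` is `𝓕 s`-strongly measurable (Fubini over the trimmed Wiener measure) and bounded by one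
  have hGbar_eq : Gbar = fun ω₁ ↦ ∫ ω₂, G (ω₁, ω₂) ∂(W.trim (brownianFiltration.le s)) := by
    funext ω₁
    simp only [hGbar]
    exact integral_trim _ (hGsec ω₁)
  have hGbar_m : StronglyMeasurable[𝓕 s] Gbar := by
    rw [hGbar_eq]
    -- Fubini measurability (`StronglyMeasurable.integral_prod_right'`) for the prescribed
    -- σ-algebras `𝓕 s` on `Ω₁` and `σ(B_v, v ≤ s)` on the Brownian factor
    exact @StronglyMeasurable.integral_prod_right' _ _ _ (𝓕 s) (brownianFiltration s) _ _ _ _ _ hG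
  have hGbar1 : ∀ ω₁, ‖Gbar ω₁‖ ≤ 1 := by
    intro ω₁
    simp only [hGbar]
    have := norm_integral_le_of_norm_le_const (μ := W) (ae_of_all _ fun ω₂ ↦ hG1 (ω₁, ω₂))
    simpa using this
  -- the weight fed to the exponential identity of `Y`
  set G' : Ω₁ → ℂ := fun ω₁ ↦ Gbar ω₁ *
      cexp (-(I * (u * Y s ω₁ : ℝ) + (u ^ 2 * (((min s (σ ω₁) : ℝ≥0) : ℝ)) / 2 : ℝ))) with hG'def
  have hYs : Measurable[𝓕 s] (Y s) := (hYad s).measurable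
  have hcs : Measurable[𝓕 s] fun ω ↦ ((min s (σ ω) : ℝ≥0) : ℝ) := (hcad s).coe_nnreal_real
  have hE' : Measurable[𝓕 s] fun ω₁ ↦
      cexp (-(I * (u * Y s ω₁ : ℝ) + (u ^ 2 * (((min s (σ ω₁) : ℝ≥0) : ℝ)) / 2 : ℝ))) :=
    (by fun_prop : Measurable fun p : ℝ × ℝ ↦ cexp (-(I * (u * p.1 : ℝ) + (u ^ 2 * p.2 / 2 : ℝ)))).comp
      (hYs.prodMk hcs)
  have hG'm : StronglyMeasurable[𝓕 s] G' := hGbar_m.mul hE'.stronglyMeasurable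
  have hG'1 : ∀ ω₁, ‖G' ω₁‖ ≤ 1 := by
    intro ω₁
    simp only [hG'def]
    rw [norm_mul, Complex.norm_exp]
    have h2 : (-(I * (u * Y s ω₁ : ℝ) + (u ^ 2 * (((min s (σ ω₁) : ℝ≥0) : ℝ)) / 2 : ℝ))).re =
        -(u ^ 2 * ((min s (σ ω₁) : ℝ≥0) : ℝ) / 2) := by
      simp only [Complex.neg_re, Complex.add_re, Complex.mul_re, Complex.I_re, Complex.I_im,
        Complex.ofReal_re, Complex.ofReal_im]
      ring
    rw [h2]
    have h3 : Real.exp (-(u ^ 2 * ((min s (σ ω₁) : ℝ≥0) : ℝ) / 2)) ≤ 1 :=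
      Real.exp_le_one_iff.2 (neg_nonpos.2 (by positivity))
    exact mul_le_one₀ (hGbar1 ω₁) (Real.exp_pos _).le h3
  have hsplit2 : ∀ ω₁, Gbar ω₁ * cexp (I * (u * (Y t ω₁ - Y s ω₁) : ℝ) +
      (u ^ 2 * (((min t (σ ω₁) : ℝ≥0) : ℝ) - ((min s (σ ω₁) : ℝ≥0) : ℝ)) / 2 : ℝ)) =
      G' ω₁ * cexp (I * (u * Y t ω₁ : ℝ) + (u ^ 2 * (((min t (σ ω₁) : ℝ≥0) : ℝ)) / 2 : ℝ)) := by
    intro ω₁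
    simp only [hG'def]
    rw [mul_assoc, ← Complex.exp_add]
    congr 2
    push_cast
    ring
  simp_rw [hsplit2]
  have e := h.integral_mul_cexp_eq hcont hst u hG'm.aestronglyMeasurable
    (ae_of_all _ hG'1)
  rw [e]
  congr 1
  funext ω₁
  simp only [hG'def, hGbar]
  rw [mul_assoc, ← Complex.exp_add, neg_add_cancel, Complex.exp_zero, mul_one]

end IdentityAE

/-! ### The concatenation is a Brownian motion -/

section ConcatAE

variable {Ω₁ : Type*} {m₁ : MeasurableSpace Ω₁} {Q : Measure Ω₁} [IsProbabilityMeasure Q]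
  {𝓕 : Filtration ℝ≥0 m₁} {Y : ℝ≥0 → Ω₁ → ℝ} {σ : Ω₁ → ℝ≥0} {N : ℝ}
  {M : ℝ≥0 → Ω₁ × (ℝ≥0 → ℝ) → ℝ}

/-- **Conditional characteristic function of the increments of the concatenation**:
`E[G e^{iu(M_t - M_s)}] = e^{-u²(t-s)/2} E[G]` for `s ≤ t` and bounded `𝓕_s ⊗ σ(B_v, v ≤ s)`-measurable
`G` (from `integral_mul_cexp_concat_eq_ae`). [cite: Legall2016, Thm 5.12 (proof)] -/
theorem integral_mul_cexp_concat_sub_eq_ae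
    (h : HasMartingaleClock Y (fun t ω ↦ ((min t (σ ω) : ℝ≥0) : ℝ)) 𝓕 Q N)
    (hcont : ∀ᵐ ω ∂Q, Continuous (Y · ω)) (hYad : ∀ t, StronglyMeasurable[𝓕 t] (Y t)) (hσm : Measurable σ)
    (hcad : ∀ t, Measurable[𝓕 t] fun ω ↦ min t (σ ω))
    (hM : M = fun t ω ↦ Y t ω.1 + (Process.brownian t ω.2 - Process.brownian (min t (σ ω.1)) ω.2))
    {s t : ℝ≥0} (hst : s ≤ t) (u : ℝ) {G : Ω₁ × (ℝ≥0 → ℝ) → ℂ}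
    (hG : StronglyMeasurable[(𝓕 s).prod (brownianFiltration s)] G) (hG1 : ∀ ω, ‖G ω‖ ≤ 1) :
    ∫ ω, G ω * cexp (I * (u * (M t ω - M s ω) : ℝ)) ∂(Q.prod Process.preWienerMeasure) =
      cexp (-(u ^ 2 * ((t : ℝ) - s) / 2 : ℝ)) * ∫ ω, G ω ∂(Q.prod Process.preWienerMeasure) := by
  have e := integral_mul_cexp_concat_eq_ae h hcont hYad hσm hcad hst u hG hG1
  have hsplit : ∀ ω : Ω₁ × (ℝ≥0 → ℝ), G ω * cexp (I * (u * ((Y t ω.1 + (Process.brownian t ω.2 -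
      Process.brownian (min t (σ ω.1)) ω.2)) - (Y s ω.1 + (Process.brownian s ω.2 -
      Process.brownian (min s (σ ω.1)) ω.2))) : ℝ) + (u ^ 2 * ((t : ℝ) - s) / 2 : ℝ)) =
      cexp ((u ^ 2 * ((t : ℝ) - s) / 2 : ℝ)) * (G ω * cexp (I * (u * (M t ω - M s ω) : ℝ))) := by
    intro ω
    rw [concat_apply hM, concat_apply hM, mul_left_comm, ← Complex.exp_add]
    congr 2
    ring
  simp_rw [hsplit] at e
  rw [integral_const_mul] at e
  have hne : cexp ((u ^ 2 * ((t : ℝ) - s) / 2 : ℝ)) ≠ 0 := Complex.exp_ne_zero _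
  calc ∫ ω, G ω * cexp (I * (u * (M t ω - M s ω) : ℝ)) ∂(Q.prod Process.preWienerMeasure)
      = (cexp ((u ^ 2 * ((t : ℝ) - s) / 2 : ℝ)))⁻¹ * ∫ ω, G ω ∂(Q.prod Process.preWienerMeasure) := by
        rw [← e, ← mul_assoc, inv_mul_cancel₀ hne, one_mul]
    _ = cexp (-(u ^ 2 * ((t : ℝ) - s) / 2 : ℝ)) * ∫ ω, G ω ∂(Q.prod Process.preWienerMeasure) := by
        simp only [← Complex.exp_neg]

/-- **Gaussian marginals of the concatenation**: `M_t ∼ 𝓝(0, t)` (when `Y_0 = 0`).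
[cite: Legall2016, Thm 5.12 (proof)] -/
theorem hasLaw_gaussianReal_concat_ae
    (h : HasMartingaleClock Y (fun t ω ↦ ((min t (σ ω) : ℝ≥0) : ℝ)) 𝓕 Q N)
    (hcont : ∀ᵐ ω ∂Q, Continuous (Y · ω)) (hYad : ∀ t, StronglyMeasurable[𝓕 t] (Y t)) (hσm : Measurable σ)
    (hcad : ∀ t, Measurable[𝓕 t] fun ω ↦ min t (σ ω)) (hY0 : ∀ ω, Y 0 ω = 0)
    (hM : M = fun t ω ↦ Y t ω.1 + (Process.brownian t ω.2 - Process.brownian (min t (σ ω.1)) ω.2))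
    (t : ℝ≥0) : HasLaw (M t) (gaussianReal 0 t) (Q.prod Process.preWienerMeasure) := by
  haveI : IsProbabilityMeasure Process.preWienerMeasure := isProbabilityMeasure_preWienerMeasure'
  have hMm : Measurable (M t) := measurable_concat hM hYad hcad t
  refine ⟨hMm.aemeasurable, Measure.ext_of_charFun (funext fun u ↦ ?_)⟩
  rw [charFun_apply_real, charFun_gaussianReal, integral_map hMm.aemeasurable (by fun_prop)]
  have key := integral_mul_cexp_concat_sub_eq_ae h hcont hYad hσm hcad hM (show (0 : ℝ≥0) ≤ t by simp) u
    (G := fun _ ↦ (1 : ℂ)) stronglyMeasurable_const (fun ω ↦ by simp)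
  simp only [one_mul, integral_const, probReal_univ, one_smul, mul_one] at key
  have h0' : (fun ω ↦ cexp (u * M t ω * I)) = fun ω ↦ cexp (I * (u * (M t ω - M 0 ω) : ℝ)) := by
    funext ω
    rw [concat_zero hM hY0, sub_zero]
    push_cast
    ring_nf
  rw [h0', key]
  congr 1
  push_cast
  ring

/-- Joint characteristic function of finitely many consecutive increments of the concatenation
along a monotone sequence of times (induction, peeling off the last increment with
`integral_mul_cexp_concat_sub_eq_ae`). [cite: Legall2016, Thm 5.12 (proof)] -/
theorem integral_cexp_sum_incr_concat_ae
    (h : HasMartingaleClock Y (fun t ω ↦ ((min t (σ ω) : ℝ≥0) : ℝ)) 𝓕 Q N)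
    (hcont : ∀ᵐ ω ∂Q, Continuous (Y · ω)) (hYad : ∀ t, StronglyMeasurable[𝓕 t] (Y t)) (hσm : Measurable σ)
    (hcad : ∀ t, Measurable[𝓕 t] fun ω ↦ min t (σ ω))
    (hM : M = fun t ω ↦ Y t ω.1 + (Process.brownian t ω.2 - Process.brownian (min t (σ ω.1)) ω.2))
    {T : ℕ → ℝ≥0} (hT : Monotone T) (ξ : ℕ → ℝ) (k : ℕ) :
    ∫ ω, cexp (I * (∑ j ∈ Finset.range k, ξ j * (M (T (j + 1)) ω - M (T j) ω) : ℝ))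
        ∂(Q.prod Process.preWienerMeasure) =
      ∏ j ∈ Finset.range k, cexp (-(ξ j ^ 2 * ((T (j + 1) : ℝ) - T j) / 2 : ℝ)) := by
  haveI : IsProbabilityMeasure Process.preWienerMeasure := isProbabilityMeasure_preWienerMeasure'
  induction k with
  | zero => simp
  | succ k ih =>
    have hGm : StronglyMeasurable[(𝓕 (T k)).prod (brownianFiltration (T k))]
        (fun ω ↦ cexp (I * (∑ j ∈ Finset.range k, ξ j * (M (T (j + 1)) ω - M (T j) ω) : ℝ))) := by
      refine ((by fun_prop : Measurable fun x : ℝ ↦ cexp (I * x)).comp ?_).stronglyMeasurable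
      refine Finset.measurable_sum _ fun j hj ↦ ?_
      have hj' : j < k := Finset.mem_range.1 hj
      exact ((measurable_concat_of_le' hM hYad hcad (hT hj')).sub
        (measurable_concat_of_le' hM hYad hcad (hT hj'.le))).const_mul _
    have hG1 : ∀ ω, ‖cexp (I * (∑ j ∈ Finset.range k, ξ j * (M (T (j + 1)) ω - M (T j) ω) : ℝ))‖ ≤ 1 :=
      fun ω ↦ by rw [Complex.norm_exp_I_mul_ofReal]
    have key := integral_mul_cexp_concat_sub_eq_ae h hcont hYad hσm hcad hM (hT (Nat.le_succ k))
      (ξ k) hGm hG1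
    have hsplit : ∀ ω, cexp (I * (∑ j ∈ Finset.range (k + 1), ξ j * (M (T (j + 1)) ω - M (T j) ω) : ℝ))
        = cexp (I * (∑ j ∈ Finset.range k, ξ j * (M (T (j + 1)) ω - M (T j) ω) : ℝ)) *
          cexp (I * (ξ k * (M (T (k + 1)) ω - M (T k) ω) : ℝ)) := by
      intro ω
      rw [← Complex.exp_add, Finset.sum_range_succ]
      push_cast; ring_nf
    simp_rw [hsplit]
    rw [key, ih, Finset.prod_range_succ, mul_comm]

/-- **Independent increments of the concatenation** (read off the factorised joint characteristic
function, Mathlib `iIndepFun_iff_charFun_pi`). [cite: Legall2016, Thm 5.12 (proof)] -/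
theorem hasIndepIncrements_concat_ae
    (h : HasMartingaleClock Y (fun t ω ↦ ((min t (σ ω) : ℝ≥0) : ℝ)) 𝓕 Q N)
    (hcont : ∀ᵐ ω ∂Q, Continuous (Y · ω)) (hYad : ∀ t, StronglyMeasurable[𝓕 t] (Y t)) (hσm : Measurable σ)
    (hcad : ∀ t, Measurable[𝓕 t] fun ω ↦ min t (σ ω))
    (hM : M = fun t ω ↦ Y t ω.1 + (Process.brownian t ω.2 - Process.brownian (min t (σ ω.1)) ω.2)) :
    HasIndepIncrements M (Q.prod Process.preWienerMeasure) := by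
  haveI : IsProbabilityMeasure Process.preWienerMeasure := isProbabilityMeasure_preWienerMeasure'
  intro n T hT
  have hXm : ∀ t, AEMeasurable (M t) (Q.prod Process.preWienerMeasure) := fun t ↦
    (measurable_concat hM hYad hcad t).aemeasurable
  have hΔm : ∀ i : Fin n, AEMeasurable (fun ω ↦ M (T i.succ) ω - M (T i.castSucc) ω)
      (Q.prod Process.preWienerMeasure) := fun i ↦ (hXm _).sub (hXm _)
  rw [iIndepFun_iff_charFun_pi hΔm]
  intro ξ
  set T' : ℕ → ℝ≥0 := fun j ↦ T ⟨min j n, Nat.lt_succ_of_le (min_le_right j n)⟩ with hT'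
  set ξ' : ℕ → ℝ := fun j ↦ if h : j < n then ξ ⟨j, h⟩ else 0 with hξ'
  have hT'm : Monotone T' := fun i j hij ↦ hT (by
    simp only [Fin.mk_le_mk]; exact min_le_min_right n hij)
  have hsucc : ∀ i : Fin n, T i.succ = T' (i + 1) := fun i ↦ by
    simp only [hT']; congr 1; ext; simp
  have hcast : ∀ i : Fin n, T i.castSucc = T' i := fun i ↦ by
    simp only [hT']; congr 1; ext; simp
  have hξi : ∀ i : Fin n, ξ i = ξ' i := fun i ↦ by simp [hξ', i.2]
  have hone : ∀ i : Fin n, charFun ((Q.prod Process.preWienerMeasure).map fun ω ↦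
      M (T i.succ) ω - M (T i.castSucc) ω) (ξ i) =
      cexp (-(ξ' i ^ 2 * ((T' (i + 1) : ℝ) - T' i) / 2 : ℝ)) := by
    intro i
    rw [charFun_apply_real, integral_map (hΔm i) (by fun_prop)]
    have hle : T i.castSucc ≤ T i.succ := hT (Fin.castSucc_lt_succ (i := i)).le
    have key := integral_mul_cexp_concat_sub_eq_ae h hcont hYad hσm hcad hM hle (ξ i)
      (G := fun _ ↦ (1 : ℂ)) stronglyMeasurable_const (fun ω ↦ by simp)
    simp only [one_mul, integral_const, probReal_univ, one_smul, mul_one] at key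
    rw [← hsucc, ← hcast, ← hξi]
    rw [← key]
    refine integral_congr_ae (ae_of_all _ fun ω ↦ ?_)
    push_cast; ring_nf
  have hinner : ∀ ω, (inner ℝ (WithLp.toLp 2 fun i : Fin n ↦ M (T i.succ) ω - M (T i.castSucc) ω) ξ : ℝ)
      = ∑ j ∈ Finset.range n, ξ' j * (M (T' (j + 1)) ω - M (T' j) ω) := by
    intro ω
    rw [PiLp.inner_apply, ← Fin.sum_univ_eq_sum_range (fun j ↦ ξ' j * (M (T' (j + 1)) ω - M (T' j) ω)) n]
    refine Finset.sum_congr rfl fun i _ ↦ ?_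
    rw [← hsucc, ← hcast, ← hξi]
    simp [mul_comm]
  have hF : AEMeasurable (fun ω ↦ WithLp.toLp 2 fun i : Fin n ↦ M (T i.succ) ω - M (T i.castSucc) ω)
      (Q.prod Process.preWienerMeasure) :=
    (WithLp.measurable_toLp 2 _).comp_aemeasurable (aemeasurable_pi_lambda _ hΔm)
  rw [charFun_apply, integral_map hF (by fun_prop)]
  simp_rw [hinner, hone]
  rw [Fin.prod_univ_eq_prod_range (fun j ↦ cexp (-(ξ' j ^ 2 * ((T' (j + 1) : ℝ) - T' j) / 2 : ℝ))) n,
    ← integral_cexp_sum_incr_concat_ae h hcont hYad hσm hcad hM hT'm ξ' n]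
  exact integral_congr_ae (ae_of_all _ fun ω ↦ congrArg cexp (mul_comm _ _))

/-- **The concatenation is a Brownian motion.** Let `Y` on `(Ω₁, 𝓕, Q)` have the martingale clock
`t ∧ σ` (`HasMartingaleClock`: `Y` and `Y² - t ∧ σ` a.e. martingales, `Y` bounded), be adapted with
continuous paths, `Y_0 = 0`, with `t ∧ σ` adapted. Then on `Ω₁ × (ℝ≥0 → ℝ)` with `Q ⊗ W` the
process `M_t(ω₁, ω₂) = Y_t(ω₁) + B_t(ω₂) - B_{t ∧ σ(ω₁)}(ω₂)` is a real Brownian motion in Mathlib's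
sense (`IsBrownianReal`: Brownian finite-dimensional laws, continuous paths), and `M_t = Y_t` for
`t ≤ σ` (`concat_eq_of_le`). Revuz–Yor (1999), Ch. V, proof of Thm (1.7) (enlarging the probability
space by an independent Brownian motion `β` and setting `B_t = M_{T_t}` for `t < ⟨M⟩_∞`,
`B_t = M_∞ + β_{t - ⟨M⟩_∞}` after); Le Gall (2016), Thm 5.12.
[cite: RevuzYor1999, Ch. V Thm (1.7) (proof)] -/
theorem isBrownianReal_concat_ae
    (h : HasMartingaleClock Y (fun t ω ↦ ((min t (σ ω) : ℝ≥0) : ℝ)) 𝓕 Q N)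
    (hcont : ∀ᵐ ω ∂Q, Continuous (Y · ω)) (hYad : ∀ t, StronglyMeasurable[𝓕 t] (Y t)) (hσm : Measurable σ)
    (hcad : ∀ t, Measurable[𝓕 t] fun ω ↦ min t (σ ω)) (hY0 : ∀ ω, Y 0 ω = 0)
    (hM : M = fun t ω ↦ Y t ω.1 + (Process.brownian t ω.2 - Process.brownian (min t (σ ω.1)) ω.2)) :
    IsBrownianReal M (Q.prod Process.preWienerMeasure) where
  toIsPreBrownianReal := HasIndepIncrements.isPreBrownianReal_of_hasLaw
    (hasLaw_gaussianReal_concat_ae h hcont hYad hσm hcad hY0 hM)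
    (hasIndepIncrements_concat_ae h hcont hYad hσm hcad hM)
  cont := by
    have h1 : ∀ᵐ ω ∂(Q.prod Process.preWienerMeasure), Continuous (Y · ω.1) :=
      Measure.quasiMeasurePreserving_fst.ae hcont
    filter_upwards [h1] with ω hω
    rw [hM]
    exact hω.add ((Process.continuous_brownian ω.2).sub
      ((Process.continuous_brownian ω.2).comp (continuous_id.min continuous_const)))

end ConcatAE

end Literature.Probability.Process
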